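/-
Copyright (c) 2026. All rights reserved.
Released under Apache 2.0 license as described in the file LICENSE.
Authors: abc-iut cell, seat abc-iut-f-069 (gen 9; row «PL2-FOX», file 1 of 3).
-/
import Literature.GroupTheory.CombinatorialGroupTheory.FoxChainPushforward
import Mathlib.Algebra.Module.Pi
import Mathlib.Algebra.BigOperators.GroupWithZero.Action
import HarnessLib

/-!
# Fox path chains, III: cocycle algebra of the chain components, the torus substitution, change of coefficients

Lyndon–Schupp, *Combinatorial Group Theory*, Ch. II §3 (Fox calculus: the product rule
`∂(uv)/∂x = ∂u/∂x + u·∂v/∂x`, its consequences for inverses, powers and conjugates, and the chain rule for a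
substitution of the generators, read in a quotient `G = F/R`) [cite: LyndonSchupp2001, Ch. II §3].

GADGET + PROOF file (classical, self-contained; two definitions — `torHom`, `mapK` — beside `thetaHom`/`mapW`; no
`Prop` definitions, no instances, no notation), abc-iut-f-069 (gen 9).  Continues `FoxPathChains.lean` (p478344) and
`FoxChainPushforward.lean` (p495153), where the Fox derivations of `F(a,b) → G` are packaged as the homomorphism into the
Fox group `W G k = (k^G × k^G) ⋊ G`.  Here, for ARBITRARY elements of `W` (so that the identities transfer verbatim to
the images of a profinite group under a continuous homomorphism into `W`):
* §1 the COCYCLE IDENTITIES of the two chain projections `w ↦ (toAdd w.left).1`, `(toAdd w.left).2` — products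
  (`fst_left_mul`), inverses (`fst_left_inv`), powers (`fst_left_pow`: `Σ_{i<j} λ_{q^i}`; `fst_left_pow_of_right_eq_one`:
  `j •` on the kernel of `W → G`), conjugates (`fst_left_conj` and its two special cases) — i.e. (c1) and the finite
  half of (c3) of the Fox package;
* §2 cyclic-sum bookkeeping for `N_B := Σ_{j<n} ρ_{B^j}` when `B^n = 1` (shift invariance, `N_B ∘ N_B = n·N_B`);
* §3 **`torHom B n c : W G k →* W G k`**, `((f₁,f₂),g) ↦ ((f₁, f₂ + c·N_B f₂), g)` — right multiplication of the
  `b`-chain by `1 + c·N_B`, which is what the TORUS substitution `a ↦ a`, `b ↦ b^{1+nq}` does to Fox chains when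
  `B^n = 1` (`torHom_wa`, `torHom_wb_eq_pow` with `c = q`); composition law `Tor_c ∘ Tor_{c'} = Tor_{c+c'+ncc'}`
  (`torHom_comp`), `torHom_inr` (it commutes with the left `G`-action);
* §4 **`mapK σ : W G k' →* W G k`** — functoriality of the Fox group in the coefficient ring along `σ : k' →+* k`
  (`mapK_wa`, `mapK_wb`), for the compatibility of Fox chains under `ℤ/M' → ℤ/M`.
Consumed by `AnabelianGeometry/EtaleTheta/SettingModelFoxLevelMaps.lean` / `…FoxLevelTorus.lean` (the level Fox
homomorphisms `F̂₂ → W G k`).  Classical combinatorial group theory; nothing here bears on [IUTchIII] Cor 3.12.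
-/

namespace Literature.GroupTheory.CombinatorialGroupTheory.FoxChain

/-! ### §1 Cocycle identities of the chain projections -/

section ChainAlgebra

variable {G : Type*} [Group G] {k : Type*} [CommRing k]

/-- `λ_g` commutes with scalars. [cite: LyndonSchupp2001, Ch. II §3] -/
theorem lt_smul (g : G) (c : k) (f : G → k) : lt g (c • f) = c • lt g f := rfl

/-- `ρ_h` commutes with scalars. [cite: LyndonSchupp2001, Ch. II §3] -/
theorem rt_smul (h : G) (c : k) (f : G → k) : rt h (c • f) = c • rt h f := rfl

/-- The `G`-component of a power. [cite: LyndonSchupp2001, Ch. II §3] -/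
theorem right_pow (w : W G k) (j : ℕ) : (w ^ j).right = w.right ^ j := by
  induction j with
  | zero => rw [pow_zero, pow_zero, SemidirectProduct.one_right]
  | succ j ih => rw [pow_succ, pow_succ, SemidirectProduct.mul_right, ih]

/-- **Product rule, `a`-chain** (`∂(ww')/∂a = ∂w/∂a + w·∂w'/∂a` read in `G`): the `a`-chain of a product is
`f₁(w) + λ_{π w} f₁(w')`. [cite: LyndonSchupp2001, Ch. II §3] -/
theorem fst_left_mul (w w' : W G k) :
    (Multiplicative.toAdd (w * w').left).1 =
      (Multiplicative.toAdd w.left).1 + lt w.right (Multiplicative.toAdd w'.left).1 := by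
  rw [SemidirectProduct.mul_left, toAdd_mul, toAdd_foxAct, Prod.fst_add]

/-- **Product rule, `b`-chain.** [cite: LyndonSchupp2001, Ch. II §3] -/
theorem snd_left_mul (w w' : W G k) :
    (Multiplicative.toAdd (w * w').left).2 =
      (Multiplicative.toAdd w.left).2 + lt w.right (Multiplicative.toAdd w'.left).2 := by
  rw [SemidirectProduct.mul_left, toAdd_mul, toAdd_foxAct, Prod.snd_add]

/-- The identity has zero `a`-chain. [cite: LyndonSchupp2001, Ch. II §3] -/
theorem fst_left_one : (Multiplicative.toAdd (1 : W G k).left).1 = 0 := rfl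

/-- The identity has zero `b`-chain. [cite: LyndonSchupp2001, Ch. II §3] -/
theorem snd_left_one : (Multiplicative.toAdd (1 : W G k).left).2 = 0 := rfl

/-- **Inverse rule, `a`-chain**: `f₁(w⁻¹) = -λ_{(π w)⁻¹} f₁(w)`. [cite: LyndonSchupp2001, Ch. II §3] -/
theorem fst_left_inv (w : W G k) :
    (Multiplicative.toAdd w⁻¹.left).1 = -lt w.right⁻¹ (Multiplicative.toAdd w.left).1 := by
  rw [SemidirectProduct.inv_left, toAdd_foxAct, toAdd_inv, Prod.fst_neg, lt_neg]

/-- **Inverse rule, `b`-chain.** [cite: LyndonSchupp2001, Ch. II §3] -/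
theorem snd_left_inv (w : W G k) :
    (Multiplicative.toAdd w⁻¹.left).2 = -lt w.right⁻¹ (Multiplicative.toAdd w.left).2 := by
  rw [SemidirectProduct.inv_left, toAdd_foxAct, toAdd_inv, Prod.snd_neg, lt_neg]

/-- **Power rule, `a`-chain**: `f₁(w^j) = Σ_{i<j} λ_{(π w)^i} f₁(w)`. [cite: LyndonSchupp2001, Ch. II §3] -/
theorem fst_left_pow (w : W G k) (j : ℕ) :
    (Multiplicative.toAdd (w ^ j).left).1 =
      ∑ i ∈ Finset.range j, lt (w.right ^ i) (Multiplicative.toAdd w.left).1 := by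
  induction j with
  | zero => rw [pow_zero, Finset.sum_range_zero]; rfl
  | succ j ih => rw [pow_succ, fst_left_mul, ih, right_pow, Finset.sum_range_succ]

/-- **Power rule, `b`-chain.** [cite: LyndonSchupp2001, Ch. II §3] -/
theorem snd_left_pow (w : W G k) (j : ℕ) :
    (Multiplicative.toAdd (w ^ j).left).2 =
      ∑ i ∈ Finset.range j, lt (w.right ^ i) (Multiplicative.toAdd w.left).2 := by
  induction j with
  | zero => rw [pow_zero, Finset.sum_range_zero]; rfl
  | succ j ih => rw [pow_succ, snd_left_mul, ih, right_pow, Finset.sum_range_succ]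

/-- **Powers on the kernel of `W → G`, `a`-chain**: if `π w = 1` then `f₁(w^j) = j • f₁(w)`.
[cite: LyndonSchupp2001, Ch. II §3] -/
theorem fst_left_pow_of_right_eq_one {w : W G k} (hw : w.right = 1) (j : ℕ) :
    (Multiplicative.toAdd (w ^ j).left).1 = j • (Multiplicative.toAdd w.left).1 := by
  rw [fst_left_pow, hw]
  simp only [one_pow, lt_one, Finset.sum_const, Finset.card_range]

/-- **Powers on the kernel of `W → G`, `b`-chain.** [cite: LyndonSchupp2001, Ch. II §3] -/
theorem snd_left_pow_of_right_eq_one {w : W G k} (hw : w.right = 1) (j : ℕ) :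
    (Multiplicative.toAdd (w ^ j).left).2 = j • (Multiplicative.toAdd w.left).2 := by
  rw [snd_left_pow, hw]
  simp only [one_pow, lt_one, Finset.sum_const, Finset.card_range]

/-- **Conjugation rule, `a`-chain**: `f₁(g w g⁻¹) = f₁(g) + λ_{π g} f₁(w) - λ_{π(gwg⁻¹)} f₁(g)`.
[cite: LyndonSchupp2001, Ch. II §3] -/
theorem fst_left_conj (g w : W G k) :
    (Multiplicative.toAdd (g * w * g⁻¹).left).1 =
      (Multiplicative.toAdd g.left).1 + lt g.right (Multiplicative.toAdd w.left).1 -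
        lt (g.right * w.right * g.right⁻¹) (Multiplicative.toAdd g.left).1 := by
  rw [fst_left_mul, fst_left_mul, fst_left_inv, SemidirectProduct.mul_right, lt_neg, ← lt_mul, ← sub_eq_add_neg]

/-- **Conjugation rule, `b`-chain.** [cite: LyndonSchupp2001, Ch. II §3] -/
theorem snd_left_conj (g w : W G k) :
    (Multiplicative.toAdd (g * w * g⁻¹).left).2 =
      (Multiplicative.toAdd g.left).2 + lt g.right (Multiplicative.toAdd w.left).2 -
        lt (g.right * w.right * g.right⁻¹) (Multiplicative.toAdd g.left).2 := by
  rw [snd_left_mul, snd_left_mul, snd_left_inv, SemidirectProduct.mul_right, lt_neg, ← lt_mul, ← sub_eq_add_neg]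

/-- Conjugating an element of the kernel of `W → G`: `f₁(g w g⁻¹) = λ_{π g} f₁(w)` when `π w = 1`.
[cite: LyndonSchupp2001, Ch. II §3] -/
theorem fst_left_conj_of_right_eq_one (g w : W G k) (hw : w.right = 1) :
    (Multiplicative.toAdd (g * w * g⁻¹).left).1 = lt g.right (Multiplicative.toAdd w.left).1 := by
  rw [fst_left_conj, hw, mul_one, mul_inv_cancel, lt_one, add_sub_cancel_left]

/-- `b`-chain version of `fst_left_conj_of_right_eq_one`. [cite: LyndonSchupp2001, Ch. II §3] -/
theorem snd_left_conj_of_right_eq_one (g w : W G k) (hw : w.right = 1) :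
    (Multiplicative.toAdd (g * w * g⁻¹).left).2 = lt g.right (Multiplicative.toAdd w.left).2 := by
  rw [snd_left_conj, hw, mul_one, mul_inv_cancel, lt_one, add_sub_cancel_left]

/-- Conjugating an element with zero `a`-chain: `f₁(g w g⁻¹) = (1 - λ_{π(gwg⁻¹)}) f₁(g)`.
[cite: LyndonSchupp2001, Ch. II §3] -/
theorem fst_left_conj_of_fst_left_eq_zero (g w : W G k) (hw : (Multiplicative.toAdd w.left).1 = 0) :
    (Multiplicative.toAdd (g * w * g⁻¹).left).1 =
      (Multiplicative.toAdd g.left).1 - lt (g.right * w.right * g.right⁻¹) (Multiplicative.toAdd g.left).1 := by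
  rw [fst_left_conj, hw, lt_zero, add_zero]

/-- Conjugating an element with zero `b`-chain. [cite: LyndonSchupp2001, Ch. II §3] -/
theorem snd_left_conj_of_snd_left_eq_zero (g w : W G k) (hw : (Multiplicative.toAdd w.left).2 = 0) :
    (Multiplicative.toAdd (g * w * g⁻¹).left).2 =
      (Multiplicative.toAdd g.left).2 - lt (g.right * w.right * g.right⁻¹) (Multiplicative.toAdd g.left).2 := by
  rw [snd_left_conj, hw, lt_zero, add_zero]

/-! ### §2 Cyclic sums `N_B = Σ_{j<n} ρ_{B^j}` for `B^n = 1` -/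

/-- Shift invariance of a sum over a period. [folklore] -/
private theorem sum_range_succ_eq_of_apply_eq {M : Type*} [AddCommGroup M] (F : ℕ → M) (n : ℕ) (hF : F n = F 0) :
    ∑ j ∈ Finset.range n, F (j + 1) = ∑ j ∈ Finset.range n, F j := by
  have h := Finset.sum_range_succ' F n
  rw [Finset.sum_range_succ, hF] at h
  exact (add_right_cancel h).symm

/-- `Σ_{j<n} e_{B^{j+1}} = Σ_{j<n} e_{B^j}` when `B^n = 1`. [cite: LyndonSchupp2001, Ch. II §3] -/
theorem sum_range_e_pow_succ [DecidableEq G] {B : G} {n : ℕ} (hB : B ^ n = 1) :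
    ∑ j ∈ Finset.range n, (e (B ^ (j + 1)) : G → k) = ∑ j ∈ Finset.range n, e (B ^ j) :=
  sum_range_succ_eq_of_apply_eq (fun j => (e (B ^ j) : G → k)) n (by simp only [hB, pow_zero])

/-- `Σ_{j<n} ρ_{B^{j+i}} f = Σ_{j<n} ρ_{B^j} f` when `B^n = 1`. [cite: LyndonSchupp2001, Ch. II §3] -/
theorem sum_range_rt_pow_add {B : G} {n : ℕ} (hB : B ^ n = 1) (f : G → k) (i : ℕ) :
    ∑ j ∈ Finset.range n, rt (B ^ (j + i)) f = ∑ j ∈ Finset.range n, rt (B ^ j) f := by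
  induction i with
  | zero => simp only [add_zero]
  | succ i ih =>
    rw [← ih]
    have h := sum_range_succ_eq_of_apply_eq (fun j => rt (B ^ (j + i)) f) n
      (by simp only [zero_add, pow_add, hB, one_mul])
    refine Eq.trans (Finset.sum_congr rfl fun j _ => ?_) h
    rw [show j + (i + 1) = j + 1 + i by omega]

/-- **`N_B (N_B f) = n · N_B f`** when `B^n = 1`. [cite: LyndonSchupp2001, Ch. II §3] -/
theorem sum_range_rt_pow_sum_range_rt_pow {B : G} {n : ℕ} (hB : B ^ n = 1) (f : G → k) :
    ∑ i ∈ Finset.range n, rt (B ^ i) (∑ j ∈ Finset.range n, rt (B ^ j) f) =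
      n • ∑ j ∈ Finset.range n, rt (B ^ j) f := by
  have h : ∀ i ∈ Finset.range n,
      rt (B ^ i) (∑ j ∈ Finset.range n, rt (B ^ j) f) = ∑ j ∈ Finset.range n, rt (B ^ j) f := by
    intro i _
    rw [rt_sum]
    simp only [← rt_mul, ← pow_add]
    exact sum_range_rt_pow_add hB f i
  rw [Finset.sum_congr rfl h, Finset.sum_const, Finset.card_range]

/-- `λ_B N'_B = N'_B` for `N'_B = Σ_{j<n} e_{B^j}`, `B^n = 1`. [cite: LyndonSchupp2001, Ch. II §3] -/
theorem lt_sum_range_e_pow [DecidableEq G] {B : G} {n : ℕ} (hB : B ^ n = 1) :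
    lt B (∑ j ∈ Finset.range n, (e (B ^ j) : G → k)) = ∑ j ∈ Finset.range n, e (B ^ j) := by
  rw [lt_sum]
  simp only [lt_e, ← pow_succ']
  exact sum_range_e_pow_succ hB

end ChainAlgebra

/-! ### §3 The torus substitution on Fox chains -/

section Torus

variable {G : Type*} [Group G] {k : Type*} [CommRing k]

/-- **The torus operator** `Tor_{B,n,c} ((f₁,f₂),g) = ((f₁, f₂ + c·Σ_{j<n} ρ_{B^j} f₂), g)` — right multiplication
of the `b`-chain by `1 + c·N_B` — as a group endomorphism of `W` (for all `B`, `n`, `c`; it is what the substitution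
`a ↦ a`, `b ↦ b^{1+nq}` does to Fox chains when `B^n = 1` and `c = q`, `torHom_wb_eq_pow`).
[cite: LyndonSchupp2001, Ch. II §3] -/
def torHom (B : G) (n : ℕ) (c : k) : W G k →* W G k where
  toFun w := ⟨Multiplicative.ofAdd ((Multiplicative.toAdd w.left).1,
      (Multiplicative.toAdd w.left).2 +
        c • ∑ j ∈ Finset.range n, rt (B ^ j) (Multiplicative.toAdd w.left).2), w.right⟩
  map_one' := by
    refine SemidirectProduct.ext ?_ rfl
    show Multiplicative.ofAdd (((0 : V2 G k)).1, (0 : V2 G k).2 +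
      c • ∑ j ∈ Finset.range n, rt (B ^ j) (0 : V2 G k).2) = Multiplicative.ofAdd 0
    simp only [Prod.fst_zero, Prod.snd_zero, rt_zero, Finset.sum_const_zero, smul_zero, add_zero,
      Prod.mk_zero_zero]
  map_mul' w w' := by
    refine SemidirectProduct.ext ?_ rfl
    apply Multiplicative.toAdd.injective
    simp only [SemidirectProduct.mul_left, toAdd_mul, toAdd_ofAdd, toAdd_foxAct, Prod.fst_add,
      Prod.snd_add, Prod.mk_add_mk, rt_add, Finset.sum_add_distrib, smul_add, lt_add, lt_smul, lt_sum, lt_rt]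
    refine Prod.ext rfl ?_
    simp only
    abel

/-- Unfolding `torHom`. [cite: LyndonSchupp2001, Ch. II §3] -/
theorem torHom_apply (B : G) (n : ℕ) (c : k) (w : W G k) :
    torHom B n c w = ⟨Multiplicative.ofAdd ((Multiplicative.toAdd w.left).1,
      (Multiplicative.toAdd w.left).2 +
        c • ∑ j ∈ Finset.range n, rt (B ^ j) (Multiplicative.toAdd w.left).2), w.right⟩ := rfl

/-- `Tor` does not change the `G`-component. [cite: LyndonSchupp2001, Ch. II §3] -/
theorem torHom_right (B : G) (n : ℕ) (c : k) (w : W G k) : (torHom B n c w).right = w.right := rfl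

/-- `Tor` does not change the `a`-chain. [cite: LyndonSchupp2001, Ch. II §3] -/
theorem fst_left_torHom (B : G) (n : ℕ) (c : k) (w : W G k) :
    (Multiplicative.toAdd (torHom B n c w).left).1 = (Multiplicative.toAdd w.left).1 := rfl

/-- `Tor` on the `b`-chain: `f₂ ↦ f₂ + c·N_B f₂`. [cite: LyndonSchupp2001, Ch. II §3] -/
theorem snd_left_torHom (B : G) (n : ℕ) (c : k) (w : W G k) :
    (Multiplicative.toAdd (torHom B n c w).left).2 =
      (Multiplicative.toAdd w.left).2 + c • ∑ j ∈ Finset.range n, rt (B ^ j) (Multiplicative.toAdd w.left).2 :=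
  rfl

/-- `Tor_0 = id`. [cite: LyndonSchupp2001, Ch. II §3] -/
theorem torHom_zero (B : G) (n : ℕ) : torHom B n (0 : k) = MonoidHom.id (W G k) := by
  refine MonoidHom.ext fun w => SemidirectProduct.ext ?_ rfl
  rw [torHom_apply, zero_smul, add_zero]
  rfl

/-- `Tor` fixes the chain-free elements `inr g` (so it commutes with the left `G`-action on chains).
[cite: LyndonSchupp2001, Ch. II §3] -/
theorem torHom_inr (B : G) (n : ℕ) (c : k) (g : G) :
    torHom B n c (SemidirectProduct.inr g) = SemidirectProduct.inr g := by
  refine SemidirectProduct.ext ?_ rfl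
  rw [torHom_apply, SemidirectProduct.left_inr]
  show Multiplicative.ofAdd (((0 : V2 G k)).1, (0 : V2 G k).2 +
    c • ∑ j ∈ Finset.range n, rt (B ^ j) (0 : V2 G k).2) = Multiplicative.ofAdd 0
  simp only [Prod.fst_zero, Prod.snd_zero, rt_zero, Finset.sum_const_zero, smul_zero, add_zero,
    Prod.mk_zero_zero]

/-- `Tor` fixes `wa A` (the substitution fixes `a`). [cite: LyndonSchupp2001, Ch. II §3] -/
theorem torHom_wa [DecidableEq G] (A B : G) (n : ℕ) (c : k) : torHom B n c (wa A : W G k) = wa A := by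
  rw [torHom_apply, wa]
  refine SemidirectProduct.ext ?_ rfl
  simp only [toAdd_ofAdd, rt_zero, Finset.sum_const_zero, smul_zero, add_zero]

/-- `Tor (wb B) = ((0, e_1 + c·Σ_{j<n} e_{B^j}), B)`. [cite: LyndonSchupp2001, Ch. II §3] -/
theorem torHom_wb [DecidableEq G] (B : G) (n : ℕ) (c : k) :
    torHom B n c (wb B : W G k) =
      ⟨Multiplicative.ofAdd (0, e 1 + c • ∑ j ∈ Finset.range n, e (B ^ j)), B⟩ := by
  rw [torHom_apply, wb]
  refine SemidirectProduct.ext ?_ rfl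
  simp only [toAdd_ofAdd, rt_e, one_mul]

/-- `(wb B)^{1+nq} = ((0, e_1 + q·Σ_{j<n} e_{B^j}), B)` when `B^n = 1`. [cite: LyndonSchupp2001, Ch. II §3] -/
theorem wb_pow_one_add_mul [DecidableEq G] {B : G} {n : ℕ} (hB : B ^ n = 1) (q : ℕ) :
    (wb B : W G k) ^ (1 + n * q) =
      ⟨Multiplicative.ofAdd (0, e 1 + (q : k) • ∑ j ∈ Finset.range n, e (B ^ j)), B⟩ := by
  induction q with
  | zero =>
    rw [mul_zero, add_zero, pow_one, Nat.cast_zero, zero_smul, add_zero]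
    rfl
  | succ q ih =>
    rw [Nat.mul_succ, ← add_assoc, pow_add, ih, wb_pow, hB]
    refine SemidirectProduct.ext ?_ ?_
    · rw [SemidirectProduct.mul_left, foxAct_apply, ← ofAdd_add, Prod.mk_add_mk]
      simp only [lt_zero, add_zero, lt_sum_range_e_pow hB, Nat.cast_succ, add_smul, one_smul, add_assoc]
    · rw [SemidirectProduct.mul_right, mul_one]

/-- **`Tor_q (wb B) = (wb B)^{1+nq}`** for `B^n = 1`: on Fox chains, `Tor_q` is the substitution `b ↦ b^{1+nq}`
(the geometric series `∂(b^{1+nq})/∂b = 1 + b + ⋯ + b^{nq} ↦ e_1 + q·N'_B`). [cite: LyndonSchupp2001, Ch. II §3] -/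
theorem torHom_wb_eq_pow [DecidableEq G] {B : G} {n : ℕ} (hB : B ^ n = 1) (q : ℕ) :
    torHom B n (q : k) (wb B : W G k) = wb B ^ (1 + n * q) := by
  rw [torHom_wb, wb_pow_one_add_mul hB]

/-- **Composition law** `Tor_c ∘ Tor_{c'} = Tor_{c + c' + n c c'}` for `B^n = 1` (because `N_B² = n N_B`).
[cite: LyndonSchupp2001, Ch. II §3] -/
theorem torHom_comp {B : G} {n : ℕ} (hB : B ^ n = 1) (c c' : k) :
    (torHom B n c).comp (torHom B n c') = torHom B n (c + c' + n * c * c') := by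
  refine MonoidHom.ext fun w => SemidirectProduct.ext ?_ rfl
  apply Multiplicative.toAdd.injective
  rw [MonoidHom.comp_apply]
  simp only [torHom_apply, toAdd_ofAdd]
  refine Prod.ext rfl ?_
  simp only [rt_add, rt_smul, Finset.sum_add_distrib, ← Finset.smul_sum,
    sum_range_rt_pow_sum_range_rt_pow hB]
  funext x
  simp only [Pi.add_apply, Pi.smul_apply, Pi.mul_apply, Pi.natCast_apply, smul_eq_mul, nsmul_eq_mul]
  ring

/-- Composition law on elements. [cite: LyndonSchupp2001, Ch. II §3] -/
theorem torHom_torHom {B : G} {n : ℕ} (hB : B ^ n = 1) (c c' : k) (w : W G k) :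
    torHom B n c (torHom B n c' w) = torHom B n (c + c' + n * c * c') w := by
  rw [← MonoidHom.comp_apply, torHom_comp hB]

end Torus

/-! ### §4 Change of the coefficient ring -/

section MapK

variable {G : Type*} [Group G] {k k' : Type*} [CommRing k] [CommRing k']

/-- **Functoriality of the Fox group in the coefficients**: a ring homomorphism `σ : k' →+* k` induces
`W G k' →* W G k`, `((f₁,f₂),g) ↦ ((σ ∘ f₁, σ ∘ f₂), g)`. [cite: LyndonSchupp2001, Ch. II §3] -/
def mapK (σ : k' →+* k) : W G k' →* W G k where
  toFun w := ⟨Multiplicative.ofAdd (⇑σ ∘ (Multiplicative.toAdd w.left).1, ⇑σ ∘ (Multiplicative.toAdd w.left).2),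
    w.right⟩
  map_one' := by
    refine SemidirectProduct.ext ?_ rfl
    show Multiplicative.ofAdd (⇑σ ∘ (0 : V2 G k').1, ⇑σ ∘ (0 : V2 G k').2) = Multiplicative.ofAdd 0
    refine congrArg Multiplicative.ofAdd (Prod.ext (funext fun q => ?_) (funext fun q => ?_)) <;>
      simp only [Function.comp_apply, Prod.fst_zero, Prod.snd_zero, Pi.zero_apply, map_zero]
  map_mul' w w' := by
    refine SemidirectProduct.ext ?_ rfl
    apply Multiplicative.toAdd.injective
    simp only [SemidirectProduct.mul_left, toAdd_mul, toAdd_ofAdd, toAdd_foxAct, Prod.fst_add, Prod.snd_add,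
      Prod.mk_add_mk]
    refine Prod.ext (funext fun q => ?_) (funext fun q => ?_) <;>
      simp only [Function.comp_apply, Pi.add_apply, map_add, lt_apply]

/-- The `G`-component is unchanged by `mapK`. [cite: LyndonSchupp2001, Ch. II §3] -/
theorem mapK_right (σ : k' →+* k) (w : W G k') : (mapK σ w).right = w.right := rfl

/-- The chains of `mapK σ w` are `σ ∘` the chains of `w`. [cite: LyndonSchupp2001, Ch. II §3] -/
theorem toAdd_mapK_left (σ : k' →+* k) (w : W G k') :
    Multiplicative.toAdd (mapK σ w).left =
      (⇑σ ∘ (Multiplicative.toAdd w.left).1, ⇑σ ∘ (Multiplicative.toAdd w.left).2) := rfl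

omit [Group G] in
/-- `σ ∘ e_g = e_g`. [cite: LyndonSchupp2001, Ch. II §3] -/
theorem comp_e [DecidableEq G] (σ : k' →+* k) (g : G) : ⇑σ ∘ (e g : G → k') = (e g : G → k) := by
  funext q
  simp only [Function.comp_apply, e]
  split_ifs
  · exact map_one σ
  · exact map_zero σ

/-- `mapK σ (wa A) = wa A`. [cite: LyndonSchupp2001, Ch. II §3] -/
theorem mapK_wa [DecidableEq G] (σ : k' →+* k) (A : G) : mapK σ (wa A : W G k') = (wa A : W G k) := by
  refine SemidirectProduct.ext ?_ rfl
  show Multiplicative.ofAdd (⇑σ ∘ (e 1 : G → k'), ⇑σ ∘ (0 : G → k')) = Multiplicative.ofAdd (e 1, 0)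
  rw [comp_e]
  refine congrArg Multiplicative.ofAdd (Prod.ext rfl (funext fun q => ?_))
  simp only [Function.comp_apply, Pi.zero_apply, map_zero]

/-- `mapK σ (wb B) = wb B`. [cite: LyndonSchupp2001, Ch. II §3] -/
theorem mapK_wb [DecidableEq G] (σ : k' →+* k) (B : G) : mapK σ (wb B : W G k') = (wb B : W G k) := by
  refine SemidirectProduct.ext ?_ rfl
  show Multiplicative.ofAdd (⇑σ ∘ (0 : G → k'), ⇑σ ∘ (e 1 : G → k')) = Multiplicative.ofAdd (0, e 1)
  rw [comp_e]
  refine congrArg Multiplicative.ofAdd (Prod.ext (funext fun q => ?_) rfl)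
  simp only [Function.comp_apply, Pi.zero_apply, map_zero]

/-- `mapK` of a chain-free element `inr g` is `inr g`. [cite: LyndonSchupp2001, Ch. II §3] -/
theorem mapK_inr (σ : k' →+* k) (g : G) :
    mapK σ (SemidirectProduct.inr g : W G k') = (SemidirectProduct.inr g : W G k) := by
  refine SemidirectProduct.ext ?_ rfl
  show Multiplicative.ofAdd (⇑σ ∘ (0 : V2 G k').1, ⇑σ ∘ (0 : V2 G k').2) = Multiplicative.ofAdd 0
  refine congrArg Multiplicative.ofAdd (Prod.ext (funext fun q => ?_) (funext fun q => ?_)) <;>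
    simp only [Function.comp_apply, Prod.fst_zero, Prod.snd_zero, Pi.zero_apply, map_zero]

end MapK

end Literature.GroupTheory.CombinatorialGroupTheory.FoxChain
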